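import Summits.BirchSwinnertonDyer.Rank1Residual.Additive.KatoDescentH2CoinvariantsFineSelmer
import Summits.BirchSwinnertonDyer.Rank1Residual.Additive.KatoDescentGlobalKummerLattice
import HarnessLib

set_option autoImplicit false

/-!
# Stub 3 of the Kato–Perrin-Riou skeletons: the counting display in LATTICE FORM — COUNT-FINE⁰ ⟸ COUNT-FINEᵃ, where
# the Kummer-log functional `φ` and its normalisation `v₀` are replaced by the integral-lattice exponent `a`
# (`H¹(ℤ[1/p], T_pW) = ℤ_p·(p^a κ_∞(P))`, potss (R1-a)) — seat `bsd-cm-prr-ty1` g10, cell `bsd-cm`; theorems only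

Sequel of `KatoDescentH2CoinvariantsFineSelmer` (E9: COUNT-EC⁰ ⟸ GZK + `thm12_4` + COUNT-FINE⁰) and
`KatoDescentGlobalKummerLattice` (E11: on the rows `integralH1 (tateRep W p) p ⊤ = ℤ_p ∙ (p^a • κ_∞(P))` and
`v₀ = a + v(log_ω P)` for every Kummer-log functional).  COUNT-FINEᵃ is COUNT-FINE⁰ with the binders
`(φ, v₀, hφ, hv₀)` replaced by `(x, a, hx : ofTop(red_{p^j} x) = κ_{p^j}(P), ha : integralH1 … ⊤ = ℤ_p ∙ (p^a • x))` and the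
conclusion «`v_p #desc(I) + v_p #(X₀)_Γ − v_p #X₀^Γ + a = v_p #Ш[p^∞] + v_p Tam + v(log_ω P)`» — the pinned form of
«`#𝐇²_Γ = #H²(ℤ[1/p], j_*T) = p^{Ш + Tam + v(log_ω P) − a}`» (potss memo §4 (R1-b)…(R1-f): `a` is the term that cancels
against Poitou–Tate's `C′/p^a`).  No Kummer-log functional, no `HasLocPKummerLog`, no `v₀` is left in the display.

* `countFine₀_of_countFineA` — COUNT-FINEᵃ → COUNT-FINE⁰ (E11 supplies `a` with `v₀ = a + v(log_ω P)`; arithmetic).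
* `countEC₀_of_gzk_of_thm12_4_of_countFineA`, `count_of_gzk_of_thm12_4_of_countFineA` — through E9.
* `rankOneCountReading_contra_of_gzk_of_thm12_4_of_countFineA hGZK hlev h12 hPRinv hFINEa :
  TorsionFree.RankOneCountReading IsKatoZetaDescentDatumOfContra Kato2004.PRRatio` — stub 3 verbatim from
  {GZK, `IsNewformOf.level_eq_conductorNorm`, `Kato2004.thm12_4`} + {PR-INV, COUNT-FINEᵃ}.

HONEST FRAMING: conditional reductions; theorems only (no definition, no named fact, no instance, no `sorry`); closes
nothing by itself; nothing about `𝐇²`, the Perrin-Riou formula or BSD is proved.  PARTITION: RANK axis × Kato–Perrin-Riou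
road (stub 3 of 19945/19223).
References: [Kato2004Asterisque] §14.9 (14.9.3), §14.14 (14.14.1)–(14.14.2), Lemma 14.15, Prop. 14.16, §14.18;
[GreenbergLNM1716] §4 Lemma 4.2; [BlochKato1990] Ex. 3.11.
-/

noncomputable section

open scoped Classical NumberField

open WeierstrassCurve Field IsDedekindDomain NumberField CategoryTheory Literature.NumberTheory.EllipticCurves
  Literature.NumberTheory.EllipticCurves.Kato2004 Literature.NumberTheory.EllipticCurves.IwasawaAlgebra
  Literature.NumberTheory.EllipticCurves.Kato2004.EulerSystemValues Literature.NumberTheory.GaloisRepresentations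
  Literature.NumberTheory.EllipticCurves.ModularForms Literature.NumberTheory.EllipticCurves.Rank1Residual
open Summit.BirchSwinnertonDyer.BirchSwinnertonDyer.Theorems.CongruentShaFreeCutKatoDescentDatumOfH2
  Summit.BirchSwinnertonDyer.Rank1Residual.Additive.GlobalKummer
open WeierstrassCurve (kummerMapTorsion)

universe u

namespace Summit.BirchSwinnertonDyer.Rank1Residual.Additive.LocPKummer

section CountFineA

/-- **COUNT-FINE⁰ ⟸ COUNT-FINEᵃ.**  COUNT-FINEᵃ = COUNT-FINE⁰ with the Kummer-log functional `φ` and its normalisation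
`φ(A) = p^{v₀}ℤ_p` replaced by the `T_p`-adic Kummer class `x = κ_∞(P)` and the exponent `a` of the integral lattice
`H¹(ℤ[1/p], T_pW) = ℤ_p ∙ (p^a • x)`, conclusion «`v_p #desc(I) + v_p #(X₀)_Γ − v_p #X₀^Γ + a = v_p #Ш[p^∞] + v_p Tam +
v(log_ω P)`».  Given COUNT-FINE⁰'s data, E11 (`exists_integralH1_eq_span_pow_smul_and_eq_add_valuation`) produces `a` with
the lattice equation and `v₀ = a + v(log_ω P)`; COUNT-FINEᵃ at `(x, a)` and arithmetic give COUNT-FINE⁰.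
[cite: Kato2004Asterisque, §14.14 (14.14.1)–(14.14.2) (p. 243), Lemma 14.15 (p. 244) and §14.18 (p. 244)]
[cite: BlochKato1990, Ex. 3.11] -/
theorem countFine₀_of_countFineA
    (hFINEa : ∀ (W : WeierstrassCurve ℚ) [W.IsElliptic] [W.IsGloballyMinimal] (p : ℕ) [Fact p.Prime],
      letI : ContinuousSMul ℤ_[p] (W.tateModule p) := TateModule.continuousSMul_padicInt
      ∀ (κ : ZpExtension ℚ p) (γ : absoluteGaloisGroup ℚ), κ.IsCyclotomic → κ.IsTopGenerator γ →
        ∀ (I : IwasawaH1Data W p κ γ) (Y : W.FineSelmerDualData κ γ⁻¹) (P : W.toAffine.Point)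
          (x : H1 (tateRep W p) ⊤) (a : ℕ),
          W.analyticRank = 1 → W.mordellWeilRank = 1 → p ≠ 2 → Addv W p → 0 ≤ padicValRat p W.j →
          ¬ p ∣ W.torsionOrder → Finite W.sha →
          Module.Finite (IwasawaAlgebra p) I.H → Module.IsTorsionFree (IwasawaAlgebra p) I.H →
          Module.rank (IwasawaAlgebra p) I.H = 1 →
          Finite I.descentCokernel → Module.Finite (IwasawaAlgebra p) Y.X → Finite (coinvariants p Y.X) →
          Finite (invariants p Y.X) →
          (∀ Q : W.toAffine.Point, ∃ n : ℤ, IsOfFinAddOrder (Q - n • P)) →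
          (∀ j : ℕ, (ofTopSubgroup (W.torsionGaloisModule ((p : ℤ) ^ j)).toTopRep 1).hom (reduceH1Pk W p j ⊤ x) =
            kummerMapTorsion W ((p : ℤ) ^ j) (zsmul_pow_surjective W p j) P) →
          integralH1 (tateRep W p) p ⊤ = Submodule.span ℤ_[p] {p ^ a • x} →
          (padicValNat p (Nat.card I.descentCokernel) : ℤ) + padicValNat p (Nat.card (coinvariants p Y.X)) -
              padicValNat p (Nat.card (invariants p Y.X)) + a =
            padicValNat p (Nat.card (AddCommGroup.primaryComponent W.sha p)) + padicValNat p W.tamagawaProduct +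
              (padicLogLocal W p
                (WeierstrassCurve.Affine.Point.map (W' := W.toAffine) (S := ℚ) (Algebra.ofId ℚ ℚ_[p]) P)).valuation) :
    ∀ (W : WeierstrassCurve ℚ) [W.IsElliptic] [W.IsGloballyMinimal] (p : ℕ) [Fact p.Prime],
      letI : ContinuousSMul ℤ_[p] (W.tateModule p) := TateModule.continuousSMul_padicInt
      ∀ (κ : ZpExtension ℚ p) (γ : absoluteGaloisGroup ℚ), κ.IsCyclotomic → κ.IsTopGenerator γ →
        ∀ (I : IwasawaH1Data W p κ γ) (Y : W.FineSelmerDualData κ γ⁻¹) (P : W.toAffine.Point)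
          (φ : integralH1 (tateRep W p) p (κ.layerSubgroup 0) →ₗ[ℤ_[p]] ℚ_[p]) (v₀ : ℤ),
          W.analyticRank = 1 → W.mordellWeilRank = 1 → p ≠ 2 → Addv W p → 0 ≤ padicValRat p W.j →
          ¬ p ∣ W.torsionOrder → Finite W.sha →
          Module.Finite (IwasawaAlgebra p) I.H → Module.IsTorsionFree (IwasawaAlgebra p) I.H →
          Module.rank (IwasawaAlgebra p) I.H = 1 →
          Finite I.descentCokernel → Module.Finite (IwasawaAlgebra p) Y.X → Finite (coinvariants p Y.X) →
          Finite (invariants p Y.X) →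
          (∀ Q : W.toAffine.Point, ∃ n : ℤ, IsOfFinAddOrder (Q - n • P)) →
          (∀ x : integralH1 (tateRep W p) p (κ.layerSubgroup 0),
            HasLocPKummerLog W p (layerZeroToTop W p κ (x : H1 (tateRep W p) (κ.layerSubgroup 0))) (φ x)) →
          LinearMap.range φ = Submodule.span ℤ_[p] {((p : ℚ_[p]) ^ v₀)} →
          (padicValNat p (Nat.card I.descentCokernel) : ℤ) + padicValNat p (Nat.card (coinvariants p Y.X)) -
              padicValNat p (Nat.card (invariants p Y.X)) + v₀ =
            padicValNat p (Nat.card (AddCommGroup.primaryComponent W.sha p)) + padicValNat p W.tamagawaProduct +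
              2 * (padicLogLocal W p
                (WeierstrassCurve.Affine.Point.map (W' := W.toAffine) (S := ℚ) (Algebra.ofId ℚ ℚ_[p]) P)).valuation := by
  intro W _ _ p _
  letI : ContinuousSMul ℤ_[p] (W.tateModule p) := TateModule.continuousSMul_padicInt
  intro κ γ hκ hγ I Y P φ v₀ hr hrank hp2 hadd hj htors hsha hfg htf hrk hdesc hYfg hXco hXinv hP hφ hv₀
  haveI := hsha
  have hsha' : Finite (AddCommGroup.primaryComponent W.sha p) := inferInstance
  -- the `T_p`-adic Kummer class of `P` and the integral lattice exponent (E11)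
  obtain ⟨x, hx⟩ := exists_forall_ofTopSubgroup_reduceH1Pk_eq_kummerMapTorsion W p (zsmul_pow_surjective W p) P
  obtain ⟨a, ha, hv₀a⟩ :=
    exists_integralH1_eq_span_pow_smul_and_eq_add_valuation W p κ hrank hsha' htors hP hx φ hφ hv₀
  have h := hFINEa W p κ γ hκ hγ I Y P x a hr hrank hp2 hadd hj htors hsha hfg htf hrk hdesc hYfg hXco hXinv hP hx ha
  rw [hv₀a]
  linarith

/-- **COUNT-EC⁰ ⟸ {GZK, `Kato2004.thm12_4`} + COUNT-FINEᵃ** (E9's `countEC₀_of_gzk_of_thm12_4_of_countFine₀` over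
`countFine₀_of_countFineA`). [cite: Kato2004Asterisque, §14.14 (14.14.1) (p. 243), Lemma 14.15 (p. 244), Thm. 12.4 (p. 221)] -/
theorem countEC₀_of_gzk_of_thm12_4_of_countFineA
    (hGZK : rank_eq_analyticRank_of_analyticRank_le_one) (h12 : Kato2004.thm12_4)
    (hFINEa : ∀ (W : WeierstrassCurve ℚ) [W.IsElliptic] [W.IsGloballyMinimal] (p : ℕ) [Fact p.Prime],
      letI : ContinuousSMul ℤ_[p] (W.tateModule p) := TateModule.continuousSMul_padicInt
      ∀ (κ : ZpExtension ℚ p) (γ : absoluteGaloisGroup ℚ), κ.IsCyclotomic → κ.IsTopGenerator γ →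
        ∀ (I : IwasawaH1Data W p κ γ) (Y : W.FineSelmerDualData κ γ⁻¹) (P : W.toAffine.Point)
          (x : H1 (tateRep W p) ⊤) (a : ℕ),
          W.analyticRank = 1 → W.mordellWeilRank = 1 → p ≠ 2 → Addv W p → 0 ≤ padicValRat p W.j →
          ¬ p ∣ W.torsionOrder → Finite W.sha →
          Module.Finite (IwasawaAlgebra p) I.H → Module.IsTorsionFree (IwasawaAlgebra p) I.H →
          Module.rank (IwasawaAlgebra p) I.H = 1 →
          Finite I.descentCokernel → Module.Finite (IwasawaAlgebra p) Y.X → Finite (coinvariants p Y.X) →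
          Finite (invariants p Y.X) →
          (∀ Q : W.toAffine.Point, ∃ n : ℤ, IsOfFinAddOrder (Q - n • P)) →
          (∀ j : ℕ, (ofTopSubgroup (W.torsionGaloisModule ((p : ℤ) ^ j)).toTopRep 1).hom (reduceH1Pk W p j ⊤ x) =
            kummerMapTorsion W ((p : ℤ) ^ j) (zsmul_pow_surjective W p j) P) →
          integralH1 (tateRep W p) p ⊤ = Submodule.span ℤ_[p] {p ^ a • x} →
          (padicValNat p (Nat.card I.descentCokernel) : ℤ) + padicValNat p (Nat.card (coinvariants p Y.X)) -
              padicValNat p (Nat.card (invariants p Y.X)) + a =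
            padicValNat p (Nat.card (AddCommGroup.primaryComponent W.sha p)) + padicValNat p W.tamagawaProduct +
              (padicLogLocal W p
                (WeierstrassCurve.Affine.Point.map (W' := W.toAffine) (S := ℚ) (Algebra.ofId ℚ ℚ_[p]) P)).valuation) :
    ∀ (W : WeierstrassCurve ℚ) [W.IsElliptic] [W.IsGloballyMinimal] (p : ℕ) [Fact p.Prime],
      letI : ContinuousSMul ℤ_[p] (W.tateModule p) := TateModule.continuousSMul_padicInt
      ∀ (κ : ZpExtension ℚ p) (γ : absoluteGaloisGroup ℚ), κ.IsCyclotomic → κ.IsTopGenerator γ →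
        ∀ (I : IwasawaH1Data W p κ γ) (J : IwasawaH2Data W p κ γ I) (P : W.toAffine.Point)
          (φ : integralH1 (tateRep W p) p (κ.layerSubgroup 0) →ₗ[ℤ_[p]] ℚ_[p]) (v₀ : ℤ),
          W.analyticRank = 1 → p ≠ 2 → Addv W p → 0 ≤ padicValRat p W.j → ¬ p ∣ W.torsionOrder →
          Finite W.sha →
          (∀ (Y : W.FineSelmerDualData κ γ⁻¹) (𝔮 : PrimeSpectrum (IwasawaAlgebra p)), 𝔮.asIdeal.height = 1 →
            Module.lengthAt (IwasawaAlgebra p) J.H2 𝔮 = Module.lengthAt (IwasawaAlgebra p) Y.X 𝔮) →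
          (∀ Q : W.toAffine.Point, ∃ n : ℤ, IsOfFinAddOrder (Q - n • P)) →
          (∀ x : integralH1 (tateRep W p) p (κ.layerSubgroup 0),
            HasLocPKummerLog W p (layerZeroToTop W p κ (x : H1 (tateRep W p) (κ.layerSubgroup 0))) (φ x)) →
          LinearMap.range φ = Submodule.span ℤ_[p] {((p : ℚ_[p]) ^ v₀)} →
          (padicValNat p (Nat.card (coinvariants p J.H2)) : ℤ) + v₀ =
            padicValNat p (Nat.card (AddCommGroup.primaryComponent W.sha p)) + padicValNat p W.tamagawaProduct +
              2 * (padicLogLocal W p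
                (WeierstrassCurve.Affine.Point.map (W' := W.toAffine) (S := ℚ) (Algebra.ofId ℚ ℚ_[p]) P)).valuation :=
  countEC₀_of_gzk_of_thm12_4_of_countFine₀ hGZK h12 (countFine₀_of_countFineA hFINEa)

/-- **STUB 3 `stub_rankOneCountReadingKato` from {GZK, `IsNewformOf.level_eq_conductorNorm`, `Kato2004.thm12_4`} + {PR-INV,
COUNT-FINEᵃ}** (verbatim the stub's type in both v4 skeletons): E9's `rankOneCountReading_contra_of_gzk_of_thm12_4_of_countFine₀`
with COUNT-FINE⁰ supplied by `countFine₀_of_countFineA`.  The displayed counting residual then mentions neither the abstract `J.H2`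
nor a Kummer-log functional: it is «`v_p #desc(I) + v_p #(X₀)_Γ − v_p #X₀^Γ + a = v_p #Ш[p^∞] + v_p Tam + v(log_ω P)`» with
`a` the exponent of the integral lattice `H¹(ℤ[1/p], T_pW) = ℤ_p·(p^a κ_∞(P))`.  Conditional reduction; closes nothing by itself.
[cite: Kato2004Asterisque, §13.9–13.12 (pp. 229–231), §14.9 (14.9.3) (p. 240), §14.14 (p. 243), Lemma 14.15 and Prop. 14.16 (p. 244)]
[cite: GreenbergLNM1716, §4 Lemma 4.2 (p. 102)] [cite: BlochKato1990, Def. 3.10 and Ex. 3.11] -/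
theorem rankOneCountReading_contra_of_gzk_of_thm12_4_of_countFineA
    (hGZK : rank_eq_analyticRank_of_analyticRank_le_one)
    (hlev : ∀ (N : ℕ) [NeZero N], IsNewformOf.level_eq_conductorNorm (N := N))
    (h12 : Kato2004.thm12_4)
    (hPRinv : ∀ (W : WeierstrassCurve ℚ) [W.IsElliptic] [W.IsGloballyMinimal] (p : ℕ) [Fact p.Prime]
      (ℒ₁ ℒ₂ : ℚ_[p]), Kato2004.PRRatio W p ℒ₁ → Kato2004.PRRatio W p ℒ₂ → ∃ w : ℚ_[p], ‖w‖ = 1 ∧ ℒ₂ = w * ℒ₁)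
    (hFINEa : ∀ (W : WeierstrassCurve ℚ) [W.IsElliptic] [W.IsGloballyMinimal] (p : ℕ) [Fact p.Prime],
      letI : ContinuousSMul ℤ_[p] (W.tateModule p) := TateModule.continuousSMul_padicInt
      ∀ (κ : ZpExtension ℚ p) (γ : absoluteGaloisGroup ℚ), κ.IsCyclotomic → κ.IsTopGenerator γ →
        ∀ (I : IwasawaH1Data W p κ γ) (Y : W.FineSelmerDualData κ γ⁻¹) (P : W.toAffine.Point)
          (x : H1 (tateRep W p) ⊤) (a : ℕ),
          W.analyticRank = 1 → W.mordellWeilRank = 1 → p ≠ 2 → Addv W p → 0 ≤ padicValRat p W.j →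
          ¬ p ∣ W.torsionOrder → Finite W.sha →
          Module.Finite (IwasawaAlgebra p) I.H → Module.IsTorsionFree (IwasawaAlgebra p) I.H →
          Module.rank (IwasawaAlgebra p) I.H = 1 →
          Finite I.descentCokernel → Module.Finite (IwasawaAlgebra p) Y.X → Finite (coinvariants p Y.X) →
          Finite (invariants p Y.X) →
          (∀ Q : W.toAffine.Point, ∃ n : ℤ, IsOfFinAddOrder (Q - n • P)) →
          (∀ j : ℕ, (ofTopSubgroup (W.torsionGaloisModule ((p : ℤ) ^ j)).toTopRep 1).hom (reduceH1Pk W p j ⊤ x) =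
            kummerMapTorsion W ((p : ℤ) ^ j) (zsmul_pow_surjective W p j) P) →
          integralH1 (tateRep W p) p ⊤ = Submodule.span ℤ_[p] {p ^ a • x} →
          (padicValNat p (Nat.card I.descentCokernel) : ℤ) + padicValNat p (Nat.card (coinvariants p Y.X)) -
              padicValNat p (Nat.card (invariants p Y.X)) + a =
            padicValNat p (Nat.card (AddCommGroup.primaryComponent W.sha p)) + padicValNat p W.tamagawaProduct +
              (padicLogLocal W p
                (WeierstrassCurve.Affine.Point.map (W' := W.toAffine) (S := ℚ) (Algebra.ofId ℚ ℚ_[p]) P)).valuation) :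
    TorsionFree.RankOneCountReading IsKatoZetaDescentDatumOfContra Kato2004.PRRatio :=
  rankOneCountReading_contra_of_gzk_of_thm12_4_of_countFine₀ hGZK hlev h12 hPRinv (countFine₀_of_countFineA hFINEa)

end CountFineA

end Summit.BirchSwinnertonDyer.Rank1Residual.Additive.LocPKummer
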